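/-
Copyright (c) 2026 the pub-hodgecm-mathlib formalisation cell (harness21).  Prover seat hodgecm-mathlib-K2E1-p02 (g5), Track B ∕ K2-LIT,
h413 = `stmt-HodgeConjecture-24833`, line `K2_E1_TraceFormulaBeta`, «EIS-RANK-ONE»: the K2Liu junction at `n = 1`, part 2 — the Borel Eisenstein series of `U(Φ₂)`
CONVERGES ABSOLUTELY on `Re s > ½` and is AUTOMORPHIC, by transport of ★ K2Liu #9 ∕ #10b.  2026-09-04.
-/
import Summits.HodgeConjecture.HodgeConjecture.Theorems.K2E1BorelEisensteinU2FromK2Liu   -- ★ part 1: the dictionary `U(Φ₂) ≅ U(𝕍 ⊕ −𝕍)`, Borel ↦ `P_Δ`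
import Summits.HodgeConjecture.HodgeConjecture.Theorems.K2E1BruhatCosetsU              -- ★ p857160 (K2E1-p09 (g4)): `borelU`, the coset type `B(L⁺)\U(Φ₂)(L⁺)`, corner test
import HarnessLib

/-!
# h413 ∕ Track B «K2-LIT», «EIS-RANK-ONE» — helper `K2E1BorelEisensteinU2FromK2LiuTransport` (K2Liu junction at `n = 1`, part 2):
# the Borel Eisenstein series of `U(Φ₂)` — absolute convergence on `Re s > ½` and left `U(Φ₂)(L⁺)`-invariance, FROM ★ K2Liu #9 ∕ #10b

Cell `pub/hodgecm-mathlib`, crux H413 = `stmt-HodgeConjecture-24833`, route `HCCMUnconditional`; chair K2-lead (g0); DEAL of the dealer K2E1-plan (g2)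
2026-09-04T03:59:41Z ∕ «=» 04:04:46Z (memo `K2/K2E1-p02/g5/MEMO-K2Liu-junction-m1.md`), standing order «EIS-RANK-ONE» (bus 04:04:57Z (ii)).  THEOREMS ONLY (no `def`,
no `instance`, no `notation`, no named-fact hypothesis, no `sorry`); lane `--kind proof --supports stmt-HodgeConjecture-24833 --as helper` (count-neutral).

E1 CURRENCY (no K2Liu object in the three final statements).  `G = U(Φ₂) = (cmDatum L 2 Φ₂)`, `Φ₂ = antidiag(1,1)` literal; rational points act through
★ `AdelicGroupData.toAdelic` on the group `U(Φ₂)(L) = unitaryGroupOfForm (cmConjRingHom L) Φ₂ ≤ GL₂(L)` of ★ p857160, with its Borel ★ `borelU` (corner test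
`g₁₀ = 0`) and the coset type `B(L⁺)\U(Φ₂)(L⁺) = Quotient (orbitRel ↥(borelU …) ↥(unitaryGroupOfForm …))` (★ `exists_equiv_option_borelQuotient_cm_two`:
`= {[1]} ⊔ {[Φ₂ n]}`).  A **Borel section of `I(s, χ)`** is `F : U(Φ₂)(𝔸) → ℂ` with `F(b g) = χ(b₀₀) · (√‖b₀₀‖_{𝔸_L})^{2s+1} · F(g)` whenever `b₁₀ = 0` (the idele `u = b₀₀`;
`(√‖u‖)^{2s+1} = ‖u‖^{s+½} = δ_B(b)^{1/2}‖u‖^s`, the normalised induction), and the **Borel Eisenstein series** is WRITTEN (not defined)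
`E(F)(g) = Σ'_{q ∈ B(L⁺)\U(Φ₂)(L⁺)} F(q̃ g)`, `q̃ = toAdelic (Quotient.out q)`.

* §1 `exists_ratEquiv` — the rational transport `ρ_S : U(Φ₂)(L⁺) ≃ H(L⁺) = ratH`, `x ↦ Ψ_S(x_𝔸)` (★ part 1 `bridge_mem_ratH` ∕ `bridge_symm_mem_arithmeticSubgroup`), with
  `ρ_S(B(L⁺)) = P_Δ(L⁺)` (★ part 1 `isSiegelDelta_bridge_iff` + ★ p857160 corner test); `exists_quotientEquiv` — the induced bijection
  `B(L⁺)\U(Φ₂)(L⁺) ≃ P_Δ(L⁺)\H(L⁺) = SiegelDeltaQuot` (Mathlib `Quotient.congr`) together with the representative relation `(e q)~ ∈ P_Δ(L⁺) · Ψ_S(q̃)`.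
* §2 **`borelEisenstein_eq_eisensteinSeriesDelta`** — for a Borel section `F`, `E(F)(g) = E^Δ(F ∘ Ψ_S⁻¹)(Ψ_S g)` (★ `eisensteinSeriesDelta`; re-indexing by `e`, Mathlib
  `Equiv.tsum_eq`, representatives by ★ K2Liu `apply_siegelDeltaRat_mul` — `F ∘ Ψ_S⁻¹` is a Siegel section by ★ part 1 `isSiegelDeltaSection_comp_bridge_symm`).
* §3 THE TRANSPORTED THEOREMS, E1 currency: **`borelEisenstein_summable`** — for `χ` unitary, `Re s > ½`, `F` a CONTINUOUS Borel section: `Σ_q |F(q̃ g)| < ∞` for every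
  `g ∈ U(Φ₂)(𝔸)` (★ K2Liu #9 `siegelEisensteinDoubledSummable` at `n = 1`: Godement's criterion, `Re s > n/2 = ½`) [MW II.1.5]; **`borelEisenstein_left_invariant`** —
  `E(F)(γ_𝔸 g) = E(F)(g)` for `γ ∈ U(Φ₂)(L⁺)` (★ K2Liu #10b) [MW II.1.5; Tan §1].

NOT HERE (next files of «EIS-RANK-ONE» for `U(Φ₂)`): the transports of ★ O41.3 (intertwining integral `M(s)` converges) and ★ O41.4 (constant term
`E_B = F + M(s)F`, the `n = 1` cells being `{1} ⊔ {w}` — measure bookkeeping `N(𝔸) ↔ N_Δ(𝔸)`), and the LIVE continuation socket K2Liu #41.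

HONEST LABEL.  Count-neutral helper; proves no printed statement; HC_CM is proved only modulo the 7 printed citations (2 remaining named inputs: hLiu418 =
`stmt-HodgeConjecture-24832`, h413 = `stmt-HodgeConjecture-24833`) until rung 0 closes.

## References
* [MoeglinWaldspurger1995] C. Mœglin, J.-L. Waldspurger, *Spectral decomposition and Eisenstein series* (1995), II.1.5 (convergence of Eisenstein series), I.1.4.
* [Tan1999] V. Tan, *Poles of Siegel Eisenstein series on U(n,n)*, Canad. J. Math. 51 (1999), §1.
* [Garrett2018] P. Garrett, *Modern Analysis of Automorphic Forms by Example*, vol. 1 (2018), §3.10 (Godement's criterion).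
-/

set_option autoImplicit false
set_option linter.dupNamespace false  -- the mandated namespace repeats the summit's segment (`HodgeConjecture.HodgeConjecture`)

noncomputable section

open scoped Matrix
open NumberField IsDedekindDomain MulAction
open Literature.NumberTheory.Automorphic Literature.NumberTheory.Automorphic.UnitaryGroup Literature.NumberTheory.GaloisRepresentations
open Literature.NumberTheory.GelbartRogawski1991 Literature.NumberTheory.GelbartRogawski1991.GRConstruction
open Literature.NumberTheory.K2Lit.SiegelDoubled
open Summit.HodgeConjecture.HodgeConjecture.Cruxes.H413.K2E1BorelEisensteinU2FromK2Liu
open Summit.HodgeConjecture.HodgeConjecture.Cruxes.H413.K2E1BruhatCosetsU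
open Summit.HodgeConjecture.HodgeConjecture.Cruxes.HLiu418.K2LiuSiegelEisensteinDoubledLeftInvariant
open Summit.HodgeConjecture.HodgeConjecture.Cruxes.HLiu418.K2LiuSiegelEisensteinDoubledSummable

namespace Summit.HodgeConjecture.HodgeConjecture.Cruxes.H413.K2E1BorelEisensteinU2FromK2LiuTransport

variable (L : Type) [Field L] [NumberField L] [IsCMField L]

/-! ## §1 The rational transport `U(Φ₂)(L⁺) ≃ H(L⁺)` and the induced bijection of coset spaces -/

/-- The diagonal embedding of the route's datum lands in its arithmetic subgroup: `x_𝔸 ∈ U(Φ₂)(L⁺) ≤ U(Φ₂)(𝔸)`. [folklore] -/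
theorem toAdelic_mem_arithmeticSubgroup (x : ↥(unitaryGroupOfForm (cmConjRingHom L) (Matrix.of fun i j : Fin 2 => if i.val + j.val + 1 = 2 then (1 : L) else 0))) :
    (cmDatum L 2 (Matrix.of fun i j : Fin 2 => if i.val + j.val + 1 = 2 then (1 : L) else 0)).toAdelic x ∈ (cmDatum L 2 (Matrix.of fun i j : Fin 2 => if i.val + j.val + 1 = 2 then (1 : L) else 0)).arithmeticSubgroup :=
  ⟨x, rfl⟩

/-- The corner entry commutes with the diagonal embedding: `(x_𝔸)₁₀ = 0 ↔ x₁₀ = 0` (injectivity of `L → 𝔸_L`). [folklore] -/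
theorem toAdelic_apply_one_zero_eq_zero_iff (x : ↥(unitaryGroupOfForm (cmConjRingHom L) (Matrix.of fun i j : Fin 2 => if i.val + j.val + 1 = 2 then (1 : L) else 0))) :
    ((((cmDatum L 2 (Matrix.of fun i j : Fin 2 => if i.val + j.val + 1 = 2 then (1 : L) else 0)).toAdelic x).1 : GL (Fin 2) (AdeleRing (𝓞 L) L)) : Matrix (Fin 2) (Fin 2) (AdeleRing (𝓞 L) L)) 1 0 = 0 ↔
      ((x : GL (Fin 2) L) : Matrix (Fin 2) (Fin 2) L) 1 0 = 0 := by
  haveI : Nontrivial (AdeleRing (𝓞 L) L) := inferInstanceAs (Nontrivial (InfiniteAdeleRing L × FiniteAdeleRing (𝓞 L) L))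
  change algebraMap L (AdeleRing (𝓞 L) L) (((x : GL (Fin 2) L) : Matrix (Fin 2) (Fin 2) L) 1 0) = 0 ↔ _
  rw [map_eq_zero_iff _ (algebraMap L (AdeleRing (𝓞 L) L)).injective]

/-- **THE RATIONAL TRANSPORT `ρ_S : U(Φ₂)(L⁺) ≃ H(L⁺)`, `x ↦ Ψ_S(x_𝔸)`** (packaged as an existence statement — no `def`): a multiplicative bijection onto ★ `ratH`
(★ part 1 `bridge_mem_ratH`, `bridge_symm_mem_arithmeticSubgroup`, injectivity of `L → 𝔸_L`) carrying the Borel `B(L⁺)` (★ `borelU`, corner test ★ p857160) onto the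
rational Siegel parabolic `P_Δ(L⁺)` (★ part 1 `isSiegelDelta_bridge_iff`). [cite: Tan1999, §1] [cite: PlatonovRapinchuk1994, §2.3] -/
theorem exists_ratTransport (S : GL (Fin 2) L) (hS : (S : Matrix (Fin 2) (Fin 2) L) = !![1, 2⁻¹; 1, -2⁻¹])
    (hS' : ((S⁻¹ : GL (Fin 2) L) : Matrix (Fin 2) (Fin 2) L) = !![2⁻¹, 2⁻¹; 1, -1]) :
    ∃ ρ : ↥(unitaryGroupOfForm (cmConjRingHom L) (Matrix.of fun i j : Fin 2 => if i.val + j.val + 1 = 2 then (1 : L) else 0)) → ratH L (Equiv.prodUnique (Fin 1) (Fin 1)) (fun _ => (1 : L)) (fun _ => map_one _) (fun _ => (1 : L)) (fun _ => map_one _),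
      (∀ x, ((ρ x : ratH L (Equiv.prodUnique (Fin 1) (Fin 1)) (fun _ => (1 : L)) (fun _ => map_one _) (fun _ => (1 : L)) (fun _ => map_one _)) : HA L (Equiv.prodUnique (Fin 1) (Fin 1)) (fun _ => (1 : L)) (fun _ => map_one _) (fun _ => (1 : L)) (fun _ => map_one _)) =
        adelicUnitaryGroupCongr L S _ _ (bridge_congr L S hS) ((cmDatum L 2 (Matrix.of fun i j : Fin 2 => if i.val + j.val + 1 = 2 then (1 : L) else 0)).toAdelic x)) ∧
      (∀ x y, ρ (x * y) = ρ x * ρ y) ∧ Function.Bijective ρ ∧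
      (∀ x, ρ x ∈ siegelDeltaRat L (Equiv.prodUnique (Fin 1) (Fin 1)) (fun _ => (1 : L)) (fun _ => map_one _) (fun _ => (1 : L)) (fun _ => map_one _) ↔ x ∈ borelU (cmConjRingHom L) (Matrix.of fun i j : Fin 2 => if i.val + j.val + 1 = 2 then (1 : L) else 0)) := by
  refine ⟨fun x => ⟨adelicUnitaryGroupCongr L S _ _ (bridge_congr L S hS) ((cmDatum L 2 (Matrix.of fun i j : Fin 2 => if i.val + j.val + 1 = 2 then (1 : L) else 0)).toAdelic x),
      bridge_mem_ratH L S hS (toAdelic_mem_arithmeticSubgroup L x)⟩, fun x => rfl, fun x y => ?_, ⟨?_, ?_⟩, fun x => ?_⟩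
  · -- multiplicativity
    apply Subtype.ext
    have h1 : (cmDatum L 2 (Matrix.of fun i j : Fin 2 => if i.val + j.val + 1 = 2 then (1 : L) else 0)).toAdelic (x * y) = (cmDatum L 2 (Matrix.of fun i j : Fin 2 => if i.val + j.val + 1 = 2 then (1 : L) else 0)).toAdelic x * (cmDatum L 2 (Matrix.of fun i j : Fin 2 => if i.val + j.val + 1 = 2 then (1 : L) else 0)).toAdelic y := map_mul _ x y
    change adelicUnitaryGroupCongr L S _ _ (bridge_congr L S hS) ((cmDatum L 2 (Matrix.of fun i j : Fin 2 => if i.val + j.val + 1 = 2 then (1 : L) else 0)).toAdelic (x * y)) =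
      adelicUnitaryGroupCongr L S _ _ (bridge_congr L S hS) ((cmDatum L 2 (Matrix.of fun i j : Fin 2 => if i.val + j.val + 1 = 2 then (1 : L) else 0)).toAdelic x) *
        adelicUnitaryGroupCongr L S _ _ (bridge_congr L S hS) ((cmDatum L 2 (Matrix.of fun i j : Fin 2 => if i.val + j.val + 1 = 2 then (1 : L) else 0)).toAdelic y)
    rw [h1]
    exact map_mul _ _ _
  · -- injectivity
    intro x y hxy
    have h1 : adelicUnitaryGroupCongr L S _ _ (bridge_congr L S hS) ((cmDatum L 2 (Matrix.of fun i j : Fin 2 => if i.val + j.val + 1 = 2 then (1 : L) else 0)).toAdelic x) =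
        adelicUnitaryGroupCongr L S _ _ (bridge_congr L S hS) ((cmDatum L 2 (Matrix.of fun i j : Fin 2 => if i.val + j.val + 1 = 2 then (1 : L) else 0)).toAdelic y) := congrArg Subtype.val hxy
    have h2 := (adelicUnitaryGroupCongr L S _ _ (bridge_congr L S hS)).injective h1
    exact Subtype.ext (toAdeleGL_injective L (congrArg Subtype.val h2))
  · -- surjectivity
    intro δ
    obtain ⟨x, hx⟩ := bridge_symm_mem_arithmeticSubgroup L S hS δ.2
    refine ⟨x, Subtype.ext ?_⟩
    change adelicUnitaryGroupCongr L S _ _ (bridge_congr L S hS) ((cmDatum L 2 (Matrix.of fun i j : Fin 2 => if i.val + j.val + 1 = 2 then (1 : L) else 0)).toAdelic x) = _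
    rw [hx]
    exact ContinuousMulEquiv.apply_symm_apply _ _
  · -- `ρ(B(L⁺)) = P_Δ(L⁺)`
    rw [siegelDeltaRat, Subgroup.mem_subgroupOf, mem_siegelDelta_iff, (mem_borelU_iff_apply_eq_zero_cm L).1 x,
      ← toAdelic_apply_one_zero_eq_zero_iff L x]
    exact isSiegelDelta_bridge_iff L S hS hS' _

/-- **THE INDUCED BIJECTION OF COSET SPACES `B(L⁺)\\U(Φ₂)(L⁺) ≃ P_Δ(L⁺)\\H(L⁺)`** (★ `SiegelDeltaQuot` of the doubled hermitian line), whose chosen representatives satisfy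
`(e q)~ = p · Ψ_S(q̃_𝔸)` with `p ∈ P_Δ(L⁺)`, `q̃ = Quotient.out q` (Mathlib `Quotient.congr` along `exists_ratTransport`). [cite: Tan1999, §1] [cite: MoeglinWaldspurger1995, II.1.5] -/
theorem exists_quotientEquiv (S : GL (Fin 2) L) (hS : (S : Matrix (Fin 2) (Fin 2) L) = !![1, 2⁻¹; 1, -2⁻¹])
    (hS' : ((S⁻¹ : GL (Fin 2) L) : Matrix (Fin 2) (Fin 2) L) = !![2⁻¹, 2⁻¹; 1, -1]) :
    ∃ (ρ : ↥(unitaryGroupOfForm (cmConjRingHom L) (Matrix.of fun i j : Fin 2 => if i.val + j.val + 1 = 2 then (1 : L) else 0)) → ratH L (Equiv.prodUnique (Fin 1) (Fin 1)) (fun _ => (1 : L)) (fun _ => map_one _) (fun _ => (1 : L)) (fun _ => map_one _))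
      (e : Quotient (orbitRel ↥(borelU (cmConjRingHom L) (Matrix.of fun i j : Fin 2 => if i.val + j.val + 1 = 2 then (1 : L) else 0))
          ↥(unitaryGroupOfForm (cmConjRingHom L) (Matrix.of fun i j : Fin 2 => if i.val + j.val + 1 = 2 then (1 : L) else 0))) ≃
        SiegelDeltaQuot L (Equiv.prodUnique (Fin 1) (Fin 1)) (fun _ => (1 : L)) (fun _ => map_one _) (fun _ => (1 : L)) (fun _ => map_one _)),
      (∀ x, ((ρ x : ratH L (Equiv.prodUnique (Fin 1) (Fin 1)) (fun _ => (1 : L)) (fun _ => map_one _) (fun _ => (1 : L)) (fun _ => map_one _)) : HA L (Equiv.prodUnique (Fin 1) (Fin 1)) (fun _ => (1 : L)) (fun _ => map_one _) (fun _ => (1 : L)) (fun _ => map_one _)) =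
        adelicUnitaryGroupCongr L S _ _ (bridge_congr L S hS) ((cmDatum L 2 (Matrix.of fun i j : Fin 2 => if i.val + j.val + 1 = 2 then (1 : L) else 0)).toAdelic x)) ∧
      ∀ q, ∃ p : siegelDeltaRat L (Equiv.prodUnique (Fin 1) (Fin 1)) (fun _ => (1 : L)) (fun _ => map_one _) (fun _ => (1 : L)) (fun _ => map_one _),
        (Quotient.out (e q) : ratH L (Equiv.prodUnique (Fin 1) (Fin 1)) (fun _ => (1 : L)) (fun _ => map_one _) (fun _ => (1 : L)) (fun _ => map_one _)) = (p : ratH L (Equiv.prodUnique (Fin 1) (Fin 1)) (fun _ => (1 : L)) (fun _ => map_one _) (fun _ => (1 : L)) (fun _ => map_one _)) * ρ (Quotient.out q) := by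
  obtain ⟨ρ, hρval, hρmul, hρbij, hρB⟩ := exists_ratTransport L S hS hS'
  have hρone : ρ 1 = 1 := by
    have h := hρmul 1 1
    rw [mul_one] at h
    exact mul_eq_left.1 h.symm
  have hρinv : ∀ x, ρ x⁻¹ = (ρ x)⁻¹ := fun x => by
    rw [eq_inv_iff_mul_eq_one, ← hρmul, inv_mul_cancel, hρone]
  obtain ⟨ρe, hρe⟩ : ∃ ρe : ↥(unitaryGroupOfForm (cmConjRingHom L) (Matrix.of fun i j : Fin 2 => if i.val + j.val + 1 = 2 then (1 : L) else 0)) ≃ ratH L (Equiv.prodUnique (Fin 1) (Fin 1)) (fun _ => (1 : L)) (fun _ => map_one _) (fun _ => (1 : L)) (fun _ => map_one _), ∀ x, ρe x = ρ x :=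
    ⟨Equiv.ofBijective ρ hρbij, fun x => rfl⟩
  have hcompat : ∀ a b, (orbitRel ↥(borelU (cmConjRingHom L) (Matrix.of fun i j : Fin 2 => if i.val + j.val + 1 = 2 then (1 : L) else 0)) _) a b ↔
      (orbitRel ↥(siegelDeltaRat L (Equiv.prodUnique (Fin 1) (Fin 1)) (fun _ => (1 : L)) (fun _ => map_one _) (fun _ => (1 : L)) (fun _ => map_one _)) _) (ρe a) (ρe b) := fun a b => by
    simp only [orbitRel_apply, mem_orbit_iff, hρe]
    constructor
    · rintro ⟨β, hβ⟩
      refine ⟨⟨ρ β, (hρB β).2 β.2⟩, ?_⟩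
      rw [Subgroup.smul_def, smul_eq_mul] at hβ ⊢
      change ρ β * ρ b = ρ a
      rw [← hρmul, hβ]
    · rintro ⟨p, hp⟩
      rw [Subgroup.smul_def, smul_eq_mul] at hp
      have hp' : ρ (a * b⁻¹) = (p : ratH L (Equiv.prodUnique (Fin 1) (Fin 1)) (fun _ => (1 : L)) (fun _ => map_one _) (fun _ => (1 : L)) (fun _ => map_one _)) := by
        rw [hρmul, hρinv, ← hp, mul_inv_cancel_right]
      have hmem : ρ (a * b⁻¹) ∈ siegelDeltaRat L (Equiv.prodUnique (Fin 1) (Fin 1)) (fun _ => (1 : L)) (fun _ => map_one _) (fun _ => (1 : L)) (fun _ => map_one _) := by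
        rw [hp']
        exact p.2
      refine ⟨⟨a * b⁻¹, (hρB _).1 hmem⟩, ?_⟩
      rw [Subgroup.smul_def, smul_eq_mul]
      change a * b⁻¹ * b = a
      rw [inv_mul_cancel_right]
  -- representatives: `y.out ∈ P_Δ(L⁺) · a` whenever `y = ⟦a⟧` (stated for a GENERAL `y : SiegelDeltaQuot`, so that the implicit setoid is elaborated uniformly)
  have hout : ∀ (y : SiegelDeltaQuot L (Equiv.prodUnique (Fin 1) (Fin 1)) (fun _ => (1 : L)) (fun _ => map_one _) (fun _ => (1 : L)) (fun _ => map_one _)) (a : ratH L (Equiv.prodUnique (Fin 1) (Fin 1)) (fun _ => (1 : L)) (fun _ => map_one _) (fun _ => (1 : L)) (fun _ => map_one _)),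
      y = Quotient.mk _ a → ∃ p : siegelDeltaRat L (Equiv.prodUnique (Fin 1) (Fin 1)) (fun _ => (1 : L)) (fun _ => map_one _) (fun _ => (1 : L)) (fun _ => map_one _), Quotient.out y = (p : ratH L (Equiv.prodUnique (Fin 1) (Fin 1)) (fun _ => (1 : L)) (fun _ => map_one _) (fun _ => (1 : L)) (fun _ => map_one _)) * a := by
    intro y a hya
    have hrel : (orbitRel ↥(siegelDeltaRat L (Equiv.prodUnique (Fin 1) (Fin 1)) (fun _ => (1 : L)) (fun _ => map_one _) (fun _ => (1 : L)) (fun _ => map_one _)) _) (Quotient.out y) a := Quotient.exact ((Quotient.out_eq y).trans hya)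
    obtain ⟨p, hp⟩ := mem_orbit_iff.1 (orbitRel_apply.1 hrel)
    refine ⟨p, ?_⟩
    rw [Subgroup.smul_def, smul_eq_mul] at hp
    exact hp.symm
  refine ⟨ρ, Quotient.congr ρe hcompat, hρval, fun q => ?_⟩
  have hq : Quotient.congr ρe hcompat q = Quotient.mk _ (ρ (Quotient.out q)) := by
    conv_lhs => rw [← Quotient.out_eq q]
    rw [← hρe]
    exact Quotient.congr_mk _ _ _
  exact hout _ _ hq

/-! ## §2 The Borel Eisenstein series of `U(Φ₂)` IS the Siegel–hermitian Eisenstein series of `U(𝕍 ⊕ −𝕍)` -/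

/-- **`E(F)(g) = E^Δ(F ∘ Ψ_S⁻¹)(Ψ_S g)`** for a Borel section `F` of `U(Φ₂)` (any `s`, `χ`; no convergence needed — `tsum` re-indexing along §1's bijection, the
representatives being absorbed by ★ `apply_siegelDeltaRat_mul` since `F ∘ Ψ_S⁻¹` is a Siegel section, ★ part 1). [cite: Tan1999, §1] [cite: MoeglinWaldspurger1995, II.1.5] -/
theorem borelEisenstein_eq_eisensteinSeriesDelta (S : GL (Fin 2) L) (hS : (S : Matrix (Fin 2) (Fin 2) L) = !![1, 2⁻¹; 1, -2⁻¹])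
    (hS' : ((S⁻¹ : GL (Fin 2) L) : Matrix (Fin 2) (Fin 2) L) = !![2⁻¹, 2⁻¹; 1, -1]) (χ : HeckeCharacter L) (s : ℂ)
    {F : (cmDatum L 2 (Matrix.of fun i j : Fin 2 => if i.val + j.val + 1 = 2 then (1 : L) else 0)).Adelic → ℂ}
    (hF : ∀ (b g : (cmDatum L 2 (Matrix.of fun i j : Fin 2 => if i.val + j.val + 1 = 2 then (1 : L) else 0)).Adelic) (u : (AdeleRing (𝓞 L) L)ˣ),
      ((b.1 : GL (Fin 2) (AdeleRing (𝓞 L) L)) : Matrix (Fin 2) (Fin 2) (AdeleRing (𝓞 L) L)) 1 0 = 0 →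
      (u : AdeleRing (𝓞 L) L) = ((b.1 : GL (Fin 2) (AdeleRing (𝓞 L) L)) : Matrix (Fin 2) (Fin 2) (AdeleRing (𝓞 L) L)) 0 0 →
        F (b * g) = ((χ u : ℂˣ) : ℂ) * ((Real.sqrt (ideleNorm u) : ℝ) : ℂ) ^ (2 * s + 1) * F g)
    (g : (cmDatum L 2 (Matrix.of fun i j : Fin 2 => if i.val + j.val + 1 = 2 then (1 : L) else 0)).Adelic) :
    ∑' q : Quotient (orbitRel ↥(borelU (cmConjRingHom L) (Matrix.of fun i j : Fin 2 => if i.val + j.val + 1 = 2 then (1 : L) else 0))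
          ↥(unitaryGroupOfForm (cmConjRingHom L) (Matrix.of fun i j : Fin 2 => if i.val + j.val + 1 = 2 then (1 : L) else 0))),
        F ((cmDatum L 2 (Matrix.of fun i j : Fin 2 => if i.val + j.val + 1 = 2 then (1 : L) else 0)).toAdelic (Quotient.out q) * g) =
      eisensteinSeriesDelta L (Equiv.prodUnique (Fin 1) (Fin 1)) (fun _ => (1 : L)) (fun _ => map_one _) (fun _ => (1 : L)) (fun _ => map_one _)
        (fun h => F ((adelicUnitaryGroupCongr L S _ _ (bridge_congr L S hS)).symm h))
        (adelicUnitaryGroupCongr L S _ _ (bridge_congr L S hS) g) := by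
  obtain ⟨ρ, e, hρval, he⟩ := exists_quotientEquiv L S hS hS'
  have hf := isSiegelDeltaSection_comp_bridge_symm L S hS hS' χ s hF
  unfold eisensteinSeriesDelta
  rw [← Equiv.tsum_eq e]
  refine tsum_congr fun q => ?_
  obtain ⟨p, hp⟩ := he q
  rw [hp, Subgroup.coe_mul, hρval, mul_assoc]
  dsimp only
  rw [apply_siegelDeltaRat_mul L _ _ _ _ _ hf p]
  change _ = F ((adelicUnitaryGroupCongr L S _ _ (bridge_congr L S hS)).symm
      (adelicUnitaryGroupCongr L S _ _ (bridge_congr L S hS) ((cmDatum L 2 (Matrix.of fun i j : Fin 2 => if i.val + j.val + 1 = 2 then (1 : L) else 0)).toAdelic (Quotient.out q)) *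
        adelicUnitaryGroupCongr L S _ _ (bridge_congr L S hS) g))
  rw [← map_mul (adelicUnitaryGroupCongr L S _ _ (bridge_congr L S hS)), ContinuousMulEquiv.symm_apply_apply]
  rfl

/-! ## §3 The transported theorems, in E1 currency -/

/-- **ABSOLUTE CONVERGENCE OF THE BOREL EISENSTEIN SERIES OF `U(Φ₂)` ON `Re s > ½`.**  For a UNITARY Hecke character `χ` of `L`, `Re s > ½`, and a CONTINUOUS Borel
section `F` of `I(s,χ)` (`F(bg) = χ(b₀₀)(√‖b₀₀‖)^{2s+1}F(g)` for `b₁₀ = 0`), the series `Σ_{q ∈ B(L⁺)\U(Φ₂)(L⁺)} |F(q̃_𝔸 g)|` converges for every `g ∈ U(Φ₂)(𝔸)`.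
TRANSPORT of ★ K2Liu #9 `siegelEisensteinDoubledSummable` (Godement's criterion `Re s > n/2`) at `n = 1` along `Ψ_S` (§1–§2).
[cite: MoeglinWaldspurger1995, II.1.5] [cite: Garrett2018, §3.10] [cite: Tan1999, §1] -/
theorem borelEisenstein_summable (χ : HeckeCharacter L) (hχ : χ.IsUnitary) (s : ℂ) (hs : (1 : ℝ) / 2 < s.re)
    {F : (cmDatum L 2 (Matrix.of fun i j : Fin 2 => if i.val + j.val + 1 = 2 then (1 : L) else 0)).Adelic → ℂ} (hFc : Continuous F)
    (hF : ∀ (b g : (cmDatum L 2 (Matrix.of fun i j : Fin 2 => if i.val + j.val + 1 = 2 then (1 : L) else 0)).Adelic) (u : (AdeleRing (𝓞 L) L)ˣ),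
      ((b.1 : GL (Fin 2) (AdeleRing (𝓞 L) L)) : Matrix (Fin 2) (Fin 2) (AdeleRing (𝓞 L) L)) 1 0 = 0 →
      (u : AdeleRing (𝓞 L) L) = ((b.1 : GL (Fin 2) (AdeleRing (𝓞 L) L)) : Matrix (Fin 2) (Fin 2) (AdeleRing (𝓞 L) L)) 0 0 →
        F (b * g) = ((χ u : ℂˣ) : ℂ) * ((Real.sqrt (ideleNorm u) : ℝ) : ℂ) ^ (2 * s + 1) * F g)
    (g : (cmDatum L 2 (Matrix.of fun i j : Fin 2 => if i.val + j.val + 1 = 2 then (1 : L) else 0)).Adelic) :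
    Summable fun q : Quotient (orbitRel ↥(borelU (cmConjRingHom L) (Matrix.of fun i j : Fin 2 => if i.val + j.val + 1 = 2 then (1 : L) else 0))
          ↥(unitaryGroupOfForm (cmConjRingHom L) (Matrix.of fun i j : Fin 2 => if i.val + j.val + 1 = 2 then (1 : L) else 0))) =>
      ‖F ((cmDatum L 2 (Matrix.of fun i j : Fin 2 => if i.val + j.val + 1 = 2 then (1 : L) else 0)).toAdelic (Quotient.out q) * g)‖ := by
  obtain ⟨S, hS, hS'⟩ := exists_bridgeMatrix L
  obtain ⟨ρ, e, hρval, he⟩ := exists_quotientEquiv L S hS hS'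
  have hf := isSiegelDeltaSection_comp_bridge_symm L S hS hS' χ s hF
  have hfc : Continuous fun h => F ((adelicUnitaryGroupCongr L S _ _ (bridge_congr L S hS)).symm h) :=
    hFc.comp (adelicUnitaryGroupCongr L S _ _ (bridge_congr L S hS)).symm.continuous
  have hs' : ((1 : ℕ) : ℝ) / 2 < s.re := by rwa [Nat.cast_one]
  have hsum := siegelEisensteinDoubledSummable L (Equiv.prodUnique (Fin 1) (Fin 1)) (fun _ => (1 : L)) (fun _ => map_one _) (fun _ => one_ne_zero) (fun _ => (1 : L)) (fun _ => map_one _) (fun _ => one_ne_zero)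
    χ hχ s hs' _ hf hfc (adelicUnitaryGroupCongr L S _ _ (bridge_congr L S hS) g)
  rw [← e.summable_iff] at hsum
  refine hsum.congr fun q => ?_
  obtain ⟨p, hp⟩ := he q
  rw [Function.comp_apply, hp, Subgroup.coe_mul, hρval, mul_assoc, apply_siegelDeltaRat_mul L _ _ _ _ _ hf p]
  change ‖F ((adelicUnitaryGroupCongr L S _ _ (bridge_congr L S hS)).symm
      (adelicUnitaryGroupCongr L S _ _ (bridge_congr L S hS) ((cmDatum L 2 (Matrix.of fun i j : Fin 2 => if i.val + j.val + 1 = 2 then (1 : L) else 0)).toAdelic (Quotient.out q)) *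
        adelicUnitaryGroupCongr L S _ _ (bridge_congr L S hS) g))‖ = _
  rw [← map_mul (adelicUnitaryGroupCongr L S _ _ (bridge_congr L S hS)), ContinuousMulEquiv.symm_apply_apply]
  rfl

/-- **LEFT `U(Φ₂)(L⁺)`-INVARIANCE OF THE BOREL EISENSTEIN SERIES OF `U(Φ₂)`**: `E(F)(γ_𝔸 g) = E(F)(g)` for `γ ∈ U(Φ₂)(L⁺)` and a Borel section `F` (any `s`, `χ`; pure algebra).
TRANSPORT of ★ K2Liu #10b `siegelEisensteinDoubledLeftInvariant` along `Ψ_S` (§2). [cite: MoeglinWaldspurger1995, II.1.5] [cite: Tan1999, §1] -/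
theorem borelEisenstein_left_invariant (χ : HeckeCharacter L) (s : ℂ)
    {F : (cmDatum L 2 (Matrix.of fun i j : Fin 2 => if i.val + j.val + 1 = 2 then (1 : L) else 0)).Adelic → ℂ}
    (hF : ∀ (b g : (cmDatum L 2 (Matrix.of fun i j : Fin 2 => if i.val + j.val + 1 = 2 then (1 : L) else 0)).Adelic) (u : (AdeleRing (𝓞 L) L)ˣ),
      ((b.1 : GL (Fin 2) (AdeleRing (𝓞 L) L)) : Matrix (Fin 2) (Fin 2) (AdeleRing (𝓞 L) L)) 1 0 = 0 →
      (u : AdeleRing (𝓞 L) L) = ((b.1 : GL (Fin 2) (AdeleRing (𝓞 L) L)) : Matrix (Fin 2) (Fin 2) (AdeleRing (𝓞 L) L)) 0 0 →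
        F (b * g) = ((χ u : ℂˣ) : ℂ) * ((Real.sqrt (ideleNorm u) : ℝ) : ℂ) ^ (2 * s + 1) * F g)
    (γ : ↥(unitaryGroupOfForm (cmConjRingHom L) (Matrix.of fun i j : Fin 2 => if i.val + j.val + 1 = 2 then (1 : L) else 0)))
    (g : (cmDatum L 2 (Matrix.of fun i j : Fin 2 => if i.val + j.val + 1 = 2 then (1 : L) else 0)).Adelic) :
    ∑' q : Quotient (orbitRel ↥(borelU (cmConjRingHom L) (Matrix.of fun i j : Fin 2 => if i.val + j.val + 1 = 2 then (1 : L) else 0))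
          ↥(unitaryGroupOfForm (cmConjRingHom L) (Matrix.of fun i j : Fin 2 => if i.val + j.val + 1 = 2 then (1 : L) else 0))),
        F ((cmDatum L 2 (Matrix.of fun i j : Fin 2 => if i.val + j.val + 1 = 2 then (1 : L) else 0)).toAdelic (Quotient.out q) * ((cmDatum L 2 (Matrix.of fun i j : Fin 2 => if i.val + j.val + 1 = 2 then (1 : L) else 0)).toAdelic γ * g)) =
      ∑' q : Quotient (orbitRel ↥(borelU (cmConjRingHom L) (Matrix.of fun i j : Fin 2 => if i.val + j.val + 1 = 2 then (1 : L) else 0))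
          ↥(unitaryGroupOfForm (cmConjRingHom L) (Matrix.of fun i j : Fin 2 => if i.val + j.val + 1 = 2 then (1 : L) else 0))),
        F ((cmDatum L 2 (Matrix.of fun i j : Fin 2 => if i.val + j.val + 1 = 2 then (1 : L) else 0)).toAdelic (Quotient.out q) * g) := by
  obtain ⟨S, hS, hS'⟩ := exists_bridgeMatrix L
  have hf := isSiegelDeltaSection_comp_bridge_symm L S hS hS' χ s hF
  have hmul : adelicUnitaryGroupCongr L S _ _ (bridge_congr L S hS) ((cmDatum L 2 (Matrix.of fun i j : Fin 2 => if i.val + j.val + 1 = 2 then (1 : L) else 0)).toAdelic γ * g) =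
      adelicUnitaryGroupCongr L S _ _ (bridge_congr L S hS) ((cmDatum L 2 (Matrix.of fun i j : Fin 2 => if i.val + j.val + 1 = 2 then (1 : L) else 0)).toAdelic γ) *
        adelicUnitaryGroupCongr L S _ _ (bridge_congr L S hS) g := map_mul _ _ _
  rw [borelEisenstein_eq_eisensteinSeriesDelta L S hS hS' χ s hF, borelEisenstein_eq_eisensteinSeriesDelta L S hS hS' χ s hF, hmul]
  exact siegelEisensteinDoubledLeftInvariant L _ _ _ _ _ χ s _ hf
    ⟨_, bridge_mem_ratH L S hS (toAdelic_mem_arithmeticSubgroup L γ)⟩ _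

end Summit.HodgeConjecture.HodgeConjecture.Cruxes.H413.K2E1BorelEisensteinU2FromK2LiuTransport

end
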